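import Summits.CriticalPhenomena.PercolationContinuityZ3.Theorems.Transplant.FKConnectivityAllQForestAdjacentTwoSum
import Summits.CriticalPhenomena.PercolationContinuityZ3.Theorems.Transplant.FKConnectivityAllQForestAdjacentFanTwoTools
import HarnessLib

/-!
# The square-free adjacent forest Rayleigh inequality is CLOSED UNDER 2-SUMS WITH BOTH PAIRS ON ONE SIDE (the substitution formula):
# the node for three side-1 fibres implies the node for the glued fibre — "a minimal counterexample has no 2-separation at all"

Support file (`--supports stmt-CriticalPhenomena-4575`), FK sub-lane `prim-bschramm-fk-1` (gen 22) of the post-continuity programme;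
builds on p205010 (kernel theorem, internal audit signed; external expert review pending).  No definitions, no named facts, no sorries;
standard axioms.

THE NODE (`AdjForestRayleighNoSqOn`): `#(Fo ∩ {e, f ∈ ω}, Fo) ≤ #(Fo ∩ {e ∈ ω}, Fo ∩ {f ∈ ω})` on a fibre `(M, u)` (`e = ov`, `f = oy`;
negative correlation in the uniform ordered two-forest partition).  g18's `adjForestNoSq_fibre_of_twoSep` (`…ForestAdjacentTwoSum`) is the
closure under 2-sums with `e` and `f` on DIFFERENT sides; this file is the complementary case, `e, f` on the SAME side `E₁` and an
arbitrary side `E₂` hanging at the separator `{a, b}` (memo bschramm/FROM-fk-1-g18-VERTEX-NC.md §4b, "same-side substitution formula",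
paper-level until now; memo bschramm/FROM-fk-1-g22-EARS.md §4).
SETTING: pairs of `E_i` on `V_i`, `V₁ ∩ V₂ ⊆ {a, b}`, `a ≠ b`, `E₁ ∩ E₂ = ∅`, `M ∪ u ⊆ E₁ ∪ E₂`, `e, f ∈ M ∩ E₁`; side fibres
`(M_i, u_i) = (M ∩ E_i, u ∩ E_i)`; `R = {a ~ b}`.
* **`adjForestNoSq_fibre_of_twoSep_sameSide`**: if on side 1
  (H0) `#₁(Fo ∩ {e,f}, Fo) ≤ #₁(Fo ∩ {e}, Fo ∩ {f})`,
  (H1) `#₁(Fo ∩ {e,f} ∩ Rᶜ, Fo) + #₁(Fo ∩ {e,f}, Fo ∩ Rᶜ) ≤ #₁(Fo ∩ {e} ∩ Rᶜ, Fo ∩ {f}) + #₁(Fo ∩ {e}, Fo ∩ {f} ∩ Rᶜ)`,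
  (H2) `#₁(Fo ∩ {e,f} ∩ Rᶜ, Fo ∩ Rᶜ) ≤ #₁(Fo ∩ {e} ∩ Rᶜ, Fo ∩ {f} ∩ Rᶜ)`
  — the node's inequalities for the side-1 fibre, for side 1 with the virtual pair `ab` added FREE, and with `ab` added PINNED — then
  `#(Fo ∩ {e,f}, Fo) ≤ #(Fo ∩ {e}, Fo ∩ {f})` on `(M, u)`.
MECHANISM.  Split over side 1 (`fibreCount_eq_sum_twoSep`); forests glue iff not both sides join `a, b`
(`isForestCfg_union_iff_of_twoSep`); so for a side-1 pair with join bits `(α, β)` the number of compatible side-2 pairs is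
`g(α, β) = n₀₀ + [¬α] n₁₀ + [¬β] n₀₁ + [¬α ∧ ¬β] n₁₁` (`n_{st}` = side-2 pairs with join bits `(s,t)`), and `n₁₀ = n₀₁` by the side-2 swap.
Hence `bad = n₀₀·B₀ + n₁₀·(B₁ + B₂) + n₁₁·B₃` and `good = n₀₀·C₀ + n₁₀·(C₁ + C₂) + n₁₁·C₃` with `B_i ≤ C_i` exactly (H0), (H1), (H2).
This is the forest case of `F(G₁ ⊕₂ G₂) = F₁F₂ − C₁C₂` applied to the Rayleigh difference with both pairs in `G₁`.
[cite: Wagner2006, Thm. 5.8, §5.3 (pp. 14–15)] [cite: SempleWelsh2008, Prop. 4.1 (p. 11); Conj. 1.1 (p. 2)] [cite: Linusson2011, Prop. 2.6]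
[cite: Grimmett2006, §3.8 (pp. 61–62)]
-/

noncomputable section

open scoped BigOperators

namespace Summit.CriticalPhenomena.PercolationContinuityZ3.Theorems

namespace FK

open Set Literature.Probability.LatticeModels Literature.Probability.Percolation
open scoped Classical symmDiff

/-! ### Bookkeeping -/

section Sums

/-- `Σ_{s} (if P x then c else 0) = #{x ∈ s | P x} · c`. [folklore] -/
theorem sum_ite_const_zero {X : Type*} (s : Finset X) (P : X → Prop) [DecidablePred P] (c : ℕ) :
    ∑ x ∈ s, (if P x then c else 0) = (s.filter P).card * c := by
  rw [Finset.sum_ite, Finset.sum_const, Finset.sum_const_zero, smul_eq_mul, add_zero]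

end Sums

/-! ### Closure of the node's fibre inequality under 2-sums (both pairs on one side) -/

section TwoSumSameSide

variable {V : Type*} [Fintype V] {E₁ E₂ : Set (Sym2 V)} {V₁ V₂ : Set V} {a b : V} {M u : BondConfig V} {e f : Sym2 V}

/-- **(♣)⁰ across a 2-separation, both pairs on one side (the substitution formula).**  With the pairs of `E_i` on `V_i`,
`V₁ ∩ V₂ ⊆ {a,b}`, `a ≠ b`, `E₁ ∩ E₂ = ∅`, a fibre `(M, u)` on `E₁ ∪ E₂` and `e, f ∈ M ∩ E₁`: the node's inequalities for the side-1
fibre (H0), for side 1 with the virtual pair `ab` free (H1, in split form) and with `ab` pinned (H2, in split form) imply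
`#_{(M,u)}(Fo ∩ {e, f ∈ ω}, Fo) ≤ #_{(M,u)}(Fo ∩ {e ∈ ω}, Fo ∩ {f ∈ ω})`. [cite: Wagner2006, Thm. 5.8, §5.3 (pp. 14–15)]
[cite: SempleWelsh2008, Conj. 1.1 (p. 2)] [cite: Linusson2011, Prop. 2.6] -/
theorem adjForestNoSq_fibre_of_twoSep_sameSide (h₁ : ∀ g ∈ E₁, ∀ z ∈ g, z ∈ V₁) (h₂ : ∀ g ∈ E₂, ∀ z ∈ g, z ∈ V₂)
    (hS : V₁ ∩ V₂ ⊆ {a, b}) (hab : a ≠ b) (hd : Disjoint E₁ E₂) (hMu : M ∪ u ⊆ E₁ ∪ E₂) (he : e ∈ M ∩ E₁) (hf : f ∈ M ∩ E₁)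
    (H0 : fibreCount (M ∩ E₁) (u ∩ E₁) (forestEv V ∩ {ω | e ∈ ω ∧ f ∈ ω}) (forestEv V) ≤
      fibreCount (M ∩ E₁) (u ∩ E₁) (forestEv V ∩ {ω | e ∈ ω}) (forestEv V ∩ {ω | f ∈ ω}))
    (H1 : fibreCount (M ∩ E₁) (u ∩ E₁) (forestEv V ∩ {ω | e ∈ ω ∧ f ∈ ω} ∩ {ω | ¬ (openGraph ω).Reachable a b}) (forestEv V) +
        fibreCount (M ∩ E₁) (u ∩ E₁) (forestEv V ∩ {ω | e ∈ ω ∧ f ∈ ω}) (forestEv V ∩ {ω | ¬ (openGraph ω).Reachable a b}) ≤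
      fibreCount (M ∩ E₁) (u ∩ E₁) (forestEv V ∩ {ω | e ∈ ω} ∩ {ω | ¬ (openGraph ω).Reachable a b}) (forestEv V ∩ {ω | f ∈ ω}) +
        fibreCount (M ∩ E₁) (u ∩ E₁) (forestEv V ∩ {ω | e ∈ ω}) (forestEv V ∩ {ω | f ∈ ω} ∩ {ω | ¬ (openGraph ω).Reachable a b}))
    (H2 : fibreCount (M ∩ E₁) (u ∩ E₁) (forestEv V ∩ {ω | e ∈ ω ∧ f ∈ ω} ∩ {ω | ¬ (openGraph ω).Reachable a b})
        (forestEv V ∩ {ω | ¬ (openGraph ω).Reachable a b}) ≤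
      fibreCount (M ∩ E₁) (u ∩ E₁) (forestEv V ∩ {ω | e ∈ ω} ∩ {ω | ¬ (openGraph ω).Reachable a b})
        (forestEv V ∩ {ω | f ∈ ω} ∩ {ω | ¬ (openGraph ω).Reachable a b})) :
    fibreCount M u (forestEv V ∩ {ω | e ∈ ω ∧ f ∈ ω}) (forestEv V) ≤
      fibreCount M u (forestEv V ∩ {ω | e ∈ ω}) (forestEv V ∩ {ω | f ∈ ω}) := by
  have hE : ∀ x, x ∈ E₁ → x ∉ E₂ := fun x hx1 hx2 => Set.disjoint_left.1 hd hx1 hx2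
  have hM1E : M ∩ E₁ ⊆ E₁ := Set.inter_subset_right
  have hM2E : M ∩ E₂ ⊆ E₂ := Set.inter_subset_right
  have heE₂ : e ∉ E₂ := hE e he.2
  have hfE₂ : f ∉ E₂ := hE f hf.2
  have sub₁ : ∀ {ω₁ : BondConfig V}, ω₁ \ (M ∩ E₁) = u ∩ E₁ → ω₁ ⊆ E₁ :=
    fun h x hx => ((subset_union_of_fibre' h) hx).elim (fun h => h.2) (fun h => h.2)
  have sub₂ : ∀ {ω₂ : BondConfig V}, ω₂ \ (M ∩ E₂) = u ∩ E₂ → ω₂ ⊆ E₂ :=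
    fun h x hx => ((subset_union_of_fibre' h) hx).elim (fun h => h.2) (fun h => h.2)
  have subB₁ : ∀ {ω₁ : BondConfig V}, ω₁ \ (M ∩ E₁) = u ∩ E₁ → ω₁ ∆ (M ∩ E₁) ⊆ E₁ :=
    fun h => (Set.symmDiff_subset_union).trans (Set.union_subset (sub₁ h) hM1E)
  have subB₂ : ∀ {ω₂ : BondConfig V}, ω₂ \ (M ∩ E₂) = u ∩ E₂ → ω₂ ∆ (M ∩ E₂) ⊆ E₂ :=
    fun h => (Set.symmDiff_subset_union).trans (Set.union_subset (sub₂ h) hM2E)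
  have glue : ∀ {ω₁ ω₂ : BondConfig V}, ω₁ ⊆ E₁ → ω₂ ⊆ E₂ →
      (IsForestCfg (ω₁ ∪ ω₂) ↔ IsForestCfg ω₁ ∧ IsForestCfg ω₂ ∧ ¬ ((openGraph ω₁).Reachable a b ∧ (openGraph ω₂).Reachable a b)) :=
    fun hω₁ hω₂ => isForestCfg_union_iff_of_twoSep h₁ h₂ hS hab hd hω₁ hω₂
  -- opaque names: side-1 classes `Sb`, `Sg`, join bits `p, q`, side-2 count `g`
  obtain ⟨Sb, hSb⟩ : ∃ s : Finset (BondConfig V), s = Finset.univ.filter fun ω₁ =>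
      ω₁ \ (M ∩ E₁) = u ∩ E₁ ∧ (e ∈ ω₁ ∧ f ∈ ω₁ ∧ IsForestCfg ω₁ ∧ IsForestCfg (ω₁ ∆ (M ∩ E₁))) := ⟨_, rfl⟩
  obtain ⟨Sg, hSg⟩ : ∃ s : Finset (BondConfig V), s = Finset.univ.filter fun ω₁ =>
      ω₁ \ (M ∩ E₁) = u ∩ E₁ ∧ (e ∈ ω₁ ∧ f ∈ ω₁ ∆ (M ∩ E₁) ∧ IsForestCfg ω₁ ∧ IsForestCfg (ω₁ ∆ (M ∩ E₁))) := ⟨_, rfl⟩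
  obtain ⟨p, hp⟩ : ∃ p : BondConfig V → Bool, ∀ ω₁, p ω₁ = decide ((openGraph ω₁).Reachable a b) := ⟨_, fun _ => rfl⟩
  obtain ⟨q, hq⟩ : ∃ q : BondConfig V → Bool, ∀ ω₁, q ω₁ = decide ((openGraph (ω₁ ∆ (M ∩ E₁))).Reachable a b) :=
    ⟨_, fun _ => rfl⟩
  obtain ⟨g, hg⟩ : ∃ g : Bool → Bool → ℕ, ∀ x y, g x y = fibreCount (M ∩ E₂) (u ∩ E₂)
      (forestEv V ∩ {ω | ¬ (x = true ∧ (openGraph ω).Reachable a b)})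
      (forestEv V ∩ {ω | ¬ (y = true ∧ (openGraph ω).Reachable a b)}) := ⟨_, fun _ _ => rfl⟩
  have hpiff : ∀ ω₁, p ω₁ = true ↔ (openGraph ω₁).Reachable a b := fun ω₁ => by rw [hp]; exact decide_eq_true_iff
  have hqiff : ∀ ω₁, q ω₁ = true ↔ (openGraph (ω₁ ∆ (M ∩ E₁))).Reachable a b := fun ω₁ => by rw [hq]; exact decide_eq_true_iff
  have hpF : ∀ ω₁, p ω₁ = false ↔ ¬ (openGraph ω₁).Reachable a b := fun ω₁ => by rw [Bool.eq_false_iff, ne_eq, hpiff]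
  have hqF : ∀ ω₁, q ω₁ = false ↔ ¬ (openGraph (ω₁ ∆ (M ∩ E₁))).Reachable a b := fun ω₁ => by
    rw [Bool.eq_false_iff, ne_eq, hqiff]
  have memSb : ∀ ω₁, ω₁ ∈ Sb ↔ ω₁ \ (M ∩ E₁) = u ∩ E₁ ∧ (e ∈ ω₁ ∧ f ∈ ω₁ ∧ IsForestCfg ω₁ ∧ IsForestCfg (ω₁ ∆ (M ∩ E₁))) :=
    fun ω₁ => by rw [hSb, Finset.mem_filter]; simp only [Finset.mem_univ, true_and]
  have memSg : ∀ ω₁, ω₁ ∈ Sg ↔ ω₁ \ (M ∩ E₁) = u ∩ E₁ ∧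
      (e ∈ ω₁ ∧ f ∈ ω₁ ∆ (M ∩ E₁) ∧ IsForestCfg ω₁ ∧ IsForestCfg (ω₁ ∆ (M ∩ E₁))) :=
    fun ω₁ => by rw [hSg, Finset.mem_filter]; simp only [Finset.mem_univ, true_and]
  have memF₁ : ∀ ω₁, ω₁ ∈ Finset.univ.filter (fun ω₁ : BondConfig V => ω₁ \ (M ∩ E₁) = u ∩ E₁) ↔ ω₁ \ (M ∩ E₁) = u ∩ E₁ :=
    fun ω₁ => by rw [Finset.mem_filter]; simp only [Finset.mem_univ, true_and]
  -- STEP 1: `bad = Σ_{Sb} g (p ω₁) (q ω₁)`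
  have hbad : fibreCount M u (forestEv V ∩ {ω | e ∈ ω ∧ f ∈ ω}) (forestEv V) = ∑ ω₁ ∈ Sb, g (p ω₁) (q ω₁) := by
    rw [fibreCount_eq_sum_twoSep hd hMu]
    symm
    refine (Finset.sum_subset (fun ω₁ hω₁ => (memF₁ ω₁).2 ((memSb ω₁).1 hω₁).1) (fun ω₁ hF₁ hnot => ?_)).symm.trans ?_ |>.symm
    · have hω₁ := (memF₁ ω₁).1 hF₁
      rw [memSb, not_and] at hnot
      refine fibreCount_eq_zero_of_forall _ _ _ _ fun ω₂ hω₂ hA hB => hnot hω₁ ?_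
      obtain ⟨hF, heω, hfω⟩ := hA
      have hF' := (glue (sub₁ hω₁) (sub₂ hω₂)).1 hF
      have hB' := (glue (subB₁ hω₁) (subB₂ hω₂)).1 hB
      exact ⟨((Set.mem_union _ _ _).1 heω).resolve_right fun h => heE₂ (sub₂ hω₂ h),
        ((Set.mem_union _ _ _).1 hfω).resolve_right fun h => hfE₂ (sub₂ hω₂ h), hF'.1, hB'.1⟩
    · refine Finset.sum_congr rfl fun ω₁ hω₁ => ?_
      obtain ⟨hω₁, heω₁, hfω₁, hF₁, hB₁⟩ := (memSb ω₁).1 hω₁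
      rw [hg]
      refine fibreCount_congr_fibre _ _ fun ω₂ hω₂ => ?_
      simp only [Set.mem_inter_iff, Set.mem_setOf_eq, forestEv, hpiff, hqiff]
      constructor
      · rintro ⟨⟨hF, -, -⟩, hB⟩
        have hF' := (glue (sub₁ hω₁) (sub₂ hω₂)).1 hF
        have hB' := (glue (subB₁ hω₁) (subB₂ hω₂)).1 hB
        exact ⟨⟨hF'.2.1, hF'.2.2⟩, hB'.2.1, hB'.2.2⟩
      · rintro ⟨⟨hF₂, hna⟩, hB₂, hnb⟩
        exact ⟨⟨(glue (sub₁ hω₁) (sub₂ hω₂)).2 ⟨hF₁, hF₂, hna⟩, Set.mem_union_left _ heω₁, Set.mem_union_left _ hfω₁⟩,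
          (glue (subB₁ hω₁) (subB₂ hω₂)).2 ⟨hB₁, hB₂, hnb⟩⟩
  -- STEP 2: `good = Σ_{Sg} g (p ω₁) (q ω₁)`
  have hgood : fibreCount M u (forestEv V ∩ {ω | e ∈ ω}) (forestEv V ∩ {ω | f ∈ ω}) = ∑ ω₁ ∈ Sg, g (p ω₁) (q ω₁) := by
    rw [fibreCount_eq_sum_twoSep hd hMu]
    symm
    refine (Finset.sum_subset (fun ω₁ hω₁ => (memF₁ ω₁).2 ((memSg ω₁).1 hω₁).1) (fun ω₁ hF₁ hnot => ?_)).symm.trans ?_ |>.symm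
    · have hω₁ := (memF₁ ω₁).1 hF₁
      rw [memSg, not_and] at hnot
      refine fibreCount_eq_zero_of_forall _ _ _ _ fun ω₂ hω₂ hA hB => hnot hω₁ ?_
      obtain ⟨hF, heω⟩ := hA
      obtain ⟨hB, hfω⟩ := hB
      have hF' := (glue (sub₁ hω₁) (sub₂ hω₂)).1 hF
      have hB' := (glue (subB₁ hω₁) (subB₂ hω₂)).1 hB
      exact ⟨((Set.mem_union _ _ _).1 heω).resolve_right fun h => heE₂ (sub₂ hω₂ h),
        ((Set.mem_union _ _ _).1 hfω).resolve_right fun h => hfE₂ (subB₂ hω₂ h), hF'.1, hB'.1⟩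
    · refine Finset.sum_congr rfl fun ω₁ hω₁ => ?_
      obtain ⟨hω₁, heω₁, hfω₁, hF₁, hB₁⟩ := (memSg ω₁).1 hω₁
      rw [hg]
      refine fibreCount_congr_fibre _ _ fun ω₂ hω₂ => ?_
      simp only [Set.mem_inter_iff, Set.mem_setOf_eq, forestEv, hpiff, hqiff]
      constructor
      · rintro ⟨⟨hF, -⟩, hB, -⟩
        have hF' := (glue (sub₁ hω₁) (sub₂ hω₂)).1 hF
        have hB' := (glue (subB₁ hω₁) (subB₂ hω₂)).1 hB
        exact ⟨⟨hF'.2.1, hF'.2.2⟩, hB'.2.1, hB'.2.2⟩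
      · rintro ⟨⟨hF₂, hna⟩, hB₂, hnb⟩
        exact ⟨⟨(glue (sub₁ hω₁) (sub₂ hω₂)).2 ⟨hF₁, hF₂, hna⟩, Set.mem_union_left _ heω₁⟩,
          (glue (subB₁ hω₁) (subB₂ hω₂)).2 ⟨hB₁, hB₂, hnb⟩, Set.mem_union_left _ hfω₁⟩
  -- STEP 3: the side-2 numbers and the expansion of `g`
  set R : Set (BondConfig V) := {ω | (openGraph ω).Reachable a b} with hR
  obtain ⟨n00, hn00⟩ : ∃ k, k = fibreCount (M ∩ E₂) (u ∩ E₂) (forestEv V ∩ Rᶜ) (forestEv V ∩ Rᶜ) := ⟨_, rfl⟩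
  obtain ⟨n10, hn10⟩ : ∃ k, k = fibreCount (M ∩ E₂) (u ∩ E₂) (forestEv V ∩ R) (forestEv V ∩ Rᶜ) := ⟨_, rfl⟩
  obtain ⟨n01, hn01⟩ : ∃ k, k = fibreCount (M ∩ E₂) (u ∩ E₂) (forestEv V ∩ Rᶜ) (forestEv V ∩ R) := ⟨_, rfl⟩
  obtain ⟨n11, hn11⟩ : ∃ k, k = fibreCount (M ∩ E₂) (u ∩ E₂) (forestEv V ∩ R) (forestEv V ∩ R) := ⟨_, rfl⟩
  have hsym : n10 = n01 := by rw [hn10, hn01]; exact fibreCount_swap _ _ _ _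
  -- splitting the second event along `R`
  have split₂ : ∀ A : Set (BondConfig V), fibreCount (M ∩ E₂) (u ∩ E₂) A (forestEv V) =
      fibreCount (M ∩ E₂) (u ∩ E₂) A (forestEv V ∩ R) + fibreCount (M ∩ E₂) (u ∩ E₂) A (forestEv V ∩ Rᶜ) := fun A => by
    rw [fibreCount_swap _ _ A (forestEv V), fibreCount_split_pred _ _ (forestEv V) A R, fibreCount_swap _ _ (forestEv V ∩ R),
      fibreCount_swap _ _ (forestEv V ∩ Rᶜ)]
  have ev_true : forestEv V ∩ {ω : BondConfig V | ¬ (true = true ∧ (openGraph ω).Reachable a b)} = forestEv V ∩ Rᶜ := by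
    ext ω; simp only [Set.mem_inter_iff, Set.mem_setOf_eq, true_and, Set.mem_compl_iff, hR]
  have ev_false : forestEv V ∩ {ω : BondConfig V | ¬ (false = true ∧ (openGraph ω).Reachable a b)} = forestEv V := by
    ext ω; simp only [Set.mem_inter_iff, Set.mem_setOf_eq, Bool.false_eq_true, false_and, not_false_eq_true, and_true]
  have hg11 : g true true = n00 := by rw [hg, ev_true, hn00]
  have hg10 : g true false = n01 + n00 := by rw [hg, ev_true, ev_false, split₂, hn01, hn00]
  have hg01 : g false true = n10 + n00 := by
    rw [hg, ev_false, ev_true, fibreCount_split_pred _ _ (forestEv V) (forestEv V ∩ Rᶜ) R, hn10, hn00]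
  have hg00 : g false false = n11 + n10 + (n01 + n00) := by
    rw [hg, ev_false, fibreCount_split_pred _ _ (forestEv V) (forestEv V) R, split₂, split₂, hn11, hn10, hn01, hn00]
  have hgexp : ∀ x y, g x y = n00 + (if x = false then n10 else 0) + (if y = false then n01 else 0) +
      (if x = false ∧ y = false then n11 else 0) := by
    intro x y
    cases x <;> cases y <;> simp [hg11, hg10, hg01, hg00] <;> omega
  -- STEP 4: the two sums in closed form
  have hsum : ∀ S : Finset (BondConfig V), ∑ ω₁ ∈ S, g (p ω₁) (q ω₁) =
      S.card * n00 + (S.filter fun ω₁ => p ω₁ = false).card * n10 + (S.filter fun ω₁ => q ω₁ = false).card * n01 +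
        (S.filter fun ω₁ => p ω₁ = false ∧ q ω₁ = false).card * n11 := by
    intro S
    rw [Finset.sum_congr rfl fun ω₁ _ => hgexp (p ω₁) (q ω₁), Finset.sum_add_distrib, Finset.sum_add_distrib,
      Finset.sum_add_distrib, Finset.sum_const, smul_eq_mul, sum_ite_const_zero, sum_ite_const_zero, sum_ite_const_zero]
  -- STEP 5: the eight side-1 numbers are the hypotheses' fibre counts
  have cB0 : Sb.card = fibreCount (M ∩ E₁) (u ∩ E₁) (forestEv V ∩ {ω | e ∈ ω ∧ f ∈ ω}) (forestEv V) := by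
    refine (fibreCount_eq_card_of_iff _ _ _ _ _ fun ω₁ => ?_).symm
    rw [memSb]; simp only [Set.mem_inter_iff, Set.mem_setOf_eq, forestEv]; tauto
  have cB1 : (Sb.filter fun ω₁ => p ω₁ = false).card =
      fibreCount (M ∩ E₁) (u ∩ E₁) (forestEv V ∩ {ω | e ∈ ω ∧ f ∈ ω} ∩ {ω | ¬ (openGraph ω).Reachable a b}) (forestEv V) := by
    refine (fibreCount_eq_card_of_iff _ _ _ _ _ fun ω₁ => ?_).symm
    rw [Finset.mem_filter, memSb, hpF]; simp only [Set.mem_inter_iff, Set.mem_setOf_eq, forestEv]; tauto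
  have cB2 : (Sb.filter fun ω₁ => q ω₁ = false).card =
      fibreCount (M ∩ E₁) (u ∩ E₁) (forestEv V ∩ {ω | e ∈ ω ∧ f ∈ ω}) (forestEv V ∩ {ω | ¬ (openGraph ω).Reachable a b}) := by
    refine (fibreCount_eq_card_of_iff _ _ _ _ _ fun ω₁ => ?_).symm
    rw [Finset.mem_filter, memSb, hqF]; simp only [Set.mem_inter_iff, Set.mem_setOf_eq, forestEv]; tauto
  have cB3 : (Sb.filter fun ω₁ => p ω₁ = false ∧ q ω₁ = false).card =
      fibreCount (M ∩ E₁) (u ∩ E₁) (forestEv V ∩ {ω | e ∈ ω ∧ f ∈ ω} ∩ {ω | ¬ (openGraph ω).Reachable a b})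
        (forestEv V ∩ {ω | ¬ (openGraph ω).Reachable a b}) := by
    refine (fibreCount_eq_card_of_iff _ _ _ _ _ fun ω₁ => ?_).symm
    rw [Finset.mem_filter, memSb, hpF, hqF]; simp only [Set.mem_inter_iff, Set.mem_setOf_eq, forestEv]; tauto
  have cC0 : Sg.card = fibreCount (M ∩ E₁) (u ∩ E₁) (forestEv V ∩ {ω | e ∈ ω}) (forestEv V ∩ {ω | f ∈ ω}) := by
    refine (fibreCount_eq_card_of_iff _ _ _ _ _ fun ω₁ => ?_).symm
    rw [memSg]; simp only [Set.mem_inter_iff, Set.mem_setOf_eq, forestEv]; tauto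
  have cC1 : (Sg.filter fun ω₁ => p ω₁ = false).card =
      fibreCount (M ∩ E₁) (u ∩ E₁) (forestEv V ∩ {ω | e ∈ ω} ∩ {ω | ¬ (openGraph ω).Reachable a b}) (forestEv V ∩ {ω | f ∈ ω}) := by
    refine (fibreCount_eq_card_of_iff _ _ _ _ _ fun ω₁ => ?_).symm
    rw [Finset.mem_filter, memSg, hpF]; simp only [Set.mem_inter_iff, Set.mem_setOf_eq, forestEv]; tauto
  have cC2 : (Sg.filter fun ω₁ => q ω₁ = false).card =
      fibreCount (M ∩ E₁) (u ∩ E₁) (forestEv V ∩ {ω | e ∈ ω}) (forestEv V ∩ {ω | f ∈ ω} ∩ {ω | ¬ (openGraph ω).Reachable a b}) := by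
    refine (fibreCount_eq_card_of_iff _ _ _ _ _ fun ω₁ => ?_).symm
    rw [Finset.mem_filter, memSg, hqF]; simp only [Set.mem_inter_iff, Set.mem_setOf_eq, forestEv]; tauto
  have cC3 : (Sg.filter fun ω₁ => p ω₁ = false ∧ q ω₁ = false).card =
      fibreCount (M ∩ E₁) (u ∩ E₁) (forestEv V ∩ {ω | e ∈ ω} ∩ {ω | ¬ (openGraph ω).Reachable a b})
        (forestEv V ∩ {ω | f ∈ ω} ∩ {ω | ¬ (openGraph ω).Reachable a b}) := by
    refine (fibreCount_eq_card_of_iff _ _ _ _ _ fun ω₁ => ?_).symm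
    rw [Finset.mem_filter, memSg, hpF, hqF]; simp only [Set.mem_inter_iff, Set.mem_setOf_eq, forestEv]; tauto
  -- STEP 6: conclude
  rw [hbad, hgood, hsum, hsum, cB0, cB1, cB2, cB3, cC0, cC1, cC2, cC3, hsym]
  have k0 := Nat.mul_le_mul_right n00 H0
  have k1 := Nat.mul_le_mul_right n01 H1
  have k2 := Nat.mul_le_mul_right n11 H2
  rw [Nat.add_mul] at k1
  rw [Nat.add_mul] at k1
  omega

end TwoSumSameSide

end FK

end Summit.CriticalPhenomena.PercolationContinuityZ3.Theorems

end
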